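import Summits.HodgeConjecture.HodgeConjecture.Theorems.F0P3ArchIsotypyCM
import Literature.NumberTheory.Rogawski1990.CohomologicalSpectrumInnerForm
import HarnessLib

/-!
# FLOOR-0 P3 — rung-1 fold S4: E2′₀ (HODGE-TYPE RIGIDITY ON THE DIAGONAL `P = P′`) from letter F1a and the value maps of
# cotangent forms, and the OFF-DIAGONAL SHRINK of letter E2′ `Rogawski1990.hodgeTypeRigid`

Cell hodgecm-mathlib, FLOOR 0, crux item H413 = stmt-HodgeConjecture-24833, line `Cruxes/H413/Lines/F0_U3CohMultOne.lean`
(rung 1, ENGINE-INTERFACES §7b: «T6a + F1 + J2 discharge only the DIAGONAL case `P = P′` of E2′ (call it E2′₀); the full E2′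
is e.v.p.-rigidity, engine-deep»).  PROOF lane (no `def`); author F0P3-p03 (g3).

* §1 `not_isHol_isAntihol_of_valueMaps` — E2′₀ for ONE discrete `P` of `U(H)` from (i) letter F1a at the CM pin
  (`P.ArchIsotypy (uFormGroup (Fin 2) (Fin 1)) (cmArchSectionUForm L ι H T hT)`, unpacked by ★ `F0P3ArchIsotypyCM`) and
  (ii) the two «form ↦ typed null value map» facts (brief B1′, F0P3-p01 (g3) `F0P3CotangentFormValueMap`; here explicit
  hypotheses `hvh` ∕ `hva` in the binder shape of ★ S2 ∕ ★ `not_both_types_archModuleCM`): `P` is not both of holomorphic and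
  of antiholomorphic cotangent type at `ι`.
* §2 `hodgeTypeRigid_of_diag_of_offDiag` — the SHRINK: letter E2′ `Rogawski1990.hodgeTypeRigid` follows from its DIAGONAL
  part (`∀ P, IsHol P → IsAntihol P → False`, no `σ`) and its OFF-DIAGONAL part (`P ≠ P′`); so once §1's inputs are theorems
  the printed-citation letter E2′ is needed only off the diagonal — which is exactly the e.v.p.-rigidity
  [Rogawski1990, Thm. 13.3.6 (c); Thm. 14.6.4 l. 1] the S-layer must supply.
References: Rogawski 1990, §15.3 ¶1, Prop. 15.2.1 (b), Thm. 13.3.6 (c) [Rogawski1990]; Borel–Wallach 2000, VI 4.11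
[BorelWallach2000]; Flath 1979, Thm. 3 [FlathCorvallis1979].
HONEST LABEL: HC_CM is proved only modulo the printed citations until rung 0 closes; this file discharges none of them.
-/

-- Mathlib idiom (as in `GKModules`, ★ F1a, ★ S0∕S2∕S3): commutator bracket on `Module.End`
attribute [local instance 100] LieRing.ofAssociativeRing

set_option autoImplicit false
set_option linter.dupNamespace false

noncomputable section

namespace Summit.HodgeConjecture.HodgeConjecture.Cruxes.H413.F0P3HodgeTypeRigidDiag

open NumberField NumberField.InfinitePlace MeasureTheory
open scoped Matrix MatrixGroups ComplexOrder
open Literature.Geometry.ComplexHyperbolic.BallModel (U21)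
open Literature.RepresentationTheory.BorelWallach2000
open Literature.NumberTheory.Automorphic Literature.NumberTheory.Automorphic.UnitaryGroup
open Literature.NumberTheory.Automorphic.UnitaryGroup.CotangentForms
open Literature.RepresentationTheory.KonnoKonno2007 Literature.RepresentationTheory.KonnoKonno2007.RealDualPair
open Literature.RepresentationTheory.KonnoKonno2007.RealDualPair.UForm
open Summit.HodgeConjecture.HodgeConjecture.Cruxes.H413.F0P3ArchIsotypyCM

/-! ## §1 E2′₀ for one `P`, from F1a at the pin and the value maps of its cotangent forms -/

section Diag

variable {L : Type} [Field L] [NumberField L] [IsCMField L] (ι : L →+* ℂ) {H : Matrix (Fin 3) (Fin 3) L}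
  (T : GL (Fin 3) ℂ) (hT : (T : Matrix (Fin 3) (Fin 3) ℂ)ᴴ * H.map ι * (T : Matrix (Fin 3) (Fin 3) ℂ) = Literature.Geometry.ComplexHyperbolic.BallModel.J)
  {μ : Measure (adelicGroupData (↥(maximalRealSubfield L)) L (IsCMField.complexConj L) 3 H).automorphicQuotient}
  [(adelicGroupData (↥(maximalRealSubfield L)) L (IsCMField.complexConj L) 3 H).IsAutomorphicMeasure μ]
  (P : DiscreteAutomorphicRep (adelicGroupData (↥(maximalRealSubfield L)) L (IsCMField.complexConj L) 3 H) μ)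

/-- **E2′₀ (Hodge-type rigidity on the diagonal) for one discrete `P`, from F1a and the value maps.**  If (F1a at the pin) the
archimedean module `P.archModuleCM ι T hT` is detected by one irreducible admissible `(𝔤, K)`-module, and every non-zero
holomorphic (resp. antiholomorphic) cotangent form `Φ` along `cmArchSection`, right-`cmCompactFactor`-invariant, with classes in
`P` yields a NON-ZERO typed-`+I` (resp. `−I`) null value map `𝔲(2,1) →ₗ[ℝ] P.archModuleCM ι T hT` (brief B1′: `φ_Φ(Y) = Σ_j
Y_{j,3} • [Φ_j]`; hypotheses `hvh`, `hva` in the binder shape of ★ `F0P3ValueMapTransport.not_both_types_of_detected`), then `P`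
is NOT simultaneously of holomorphic and of antiholomorphic cotangent type at `ι` — ★ `not_both_types_archModuleCM` (T6a on the
detecting module). [cite: Rogawski1990, §15.3 ¶1; Prop. 15.2.1 (b)] [cite: BorelWallach2000, VI Thm. 4.11] [cite: FlathCorvallis1979, Thm. 3] -/
theorem not_isHol_isAntihol_of_valueMaps
    (hF1a : P.ArchIsotypy (uFormGroup (Fin 2) (Fin 1)) (cmArchSectionUForm L ι H T hT))
    (hvh : ∀ Φ ∈ holCotForms (↥(maximalRealSubfield L)) L (IsCMField.complexConj L) 3 H (cmArchSection L ι H T hT)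
        (cmCompactFactor L ι H T hT), Φ ≠ 0 → P.ContainsForm Φ →
      ∃ φ : (uFormGroup (Fin 2) (Fin 1)).lie →ₗ[ℝ] P.archModuleCM ι T hT, φ ≠ 0 ∧
        (∀ W ∈ (uFormGroup (Fin 2) (Fin 1)).kInLie, φ W = 0) ∧
        (∀ (k : (uFormGroup (Fin 2) (Fin 1)).maximalCompact) (X : (uFormGroup (Fin 2) (Fin 1)).lie),
          P.archRepKCM ι T hT k (φ X) =
            φ ((uFormGroup (Fin 2) (Fin 1)).Ad (Subgroup.inclusion (uFormGroup (Fin 2) (Fin 1)).maximalCompact_le_carrier k) X)) ∧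
        (∀ W ∈ (uFormGroup (Fin 2) (Fin 1)).kInLie, ∀ X : (uFormGroup (Fin 2) (Fin 1)).lie,
          φ ⁅W, X⁆ = P.archRepLieCM ι T hT W (φ X)) ∧
        (∀ X : (uFormGroup (Fin 2) (Fin 1)).lie,
          P.archRepLieCM ι T hT (upqZ0 (Fin 2) (Fin 1)) (φ X) = Complex.I • φ X) ∧
        (∀ (X : (uFormGroup (Fin 2) (Fin 1)).lie) (s : (Fin 2 × Fin 1) × Fin 2),
          P.archRepLieCM ι T hT (upqPBasis s) (φ X) +
            Complex.I • P.archRepLieCM ι T hT ⁅upqZ0 (Fin 2) (Fin 1), upqPBasis s⁆ (φ X) = 0))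
    (hva : ∀ Ψ ∈ (holCotForms (↥(maximalRealSubfield L)) L (IsCMField.complexConj L) 3 H (cmArchSection L ι H T hT)
        (cmCompactFactor L ι H T hT)).map (conjFun (↥(maximalRealSubfield L)) L (IsCMField.complexConj L) 3 H),
        Ψ ≠ 0 → P.ContainsForm Ψ →
      ∃ φ : (uFormGroup (Fin 2) (Fin 1)).lie →ₗ[ℝ] P.archModuleCM ι T hT, φ ≠ 0 ∧
        (∀ W ∈ (uFormGroup (Fin 2) (Fin 1)).kInLie, φ W = 0) ∧
        (∀ (k : (uFormGroup (Fin 2) (Fin 1)).maximalCompact) (X : (uFormGroup (Fin 2) (Fin 1)).lie),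
          P.archRepKCM ι T hT k (φ X) =
            φ ((uFormGroup (Fin 2) (Fin 1)).Ad (Subgroup.inclusion (uFormGroup (Fin 2) (Fin 1)).maximalCompact_le_carrier k) X)) ∧
        (∀ W ∈ (uFormGroup (Fin 2) (Fin 1)).kInLie, ∀ X : (uFormGroup (Fin 2) (Fin 1)).lie,
          φ ⁅W, X⁆ = P.archRepLieCM ι T hT W (φ X)) ∧
        (∀ X : (uFormGroup (Fin 2) (Fin 1)).lie,
          P.archRepLieCM ι T hT (upqZ0 (Fin 2) (Fin 1)) (φ X) = (-Complex.I) • φ X) ∧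
        (∀ (X : (uFormGroup (Fin 2) (Fin 1)).lie) (s : (Fin 2 × Fin 1) × Fin 2),
          P.archRepLieCM ι T hT (upqPBasis s) (φ X) +
            (-Complex.I) • P.archRepLieCM ι T hT ⁅upqZ0 (Fin 2) (Fin 1), upqPBasis s⁆ (φ X) = 0)) :
    P.IsHolCotangentAt (cmArchSection L ι H T hT) (cmCompactFactor L ι H T hT) →
      P.IsAntiholCotangentAt (cmArchSection L ι H T hT) (cmCompactFactor L ι H T hT) → False := by
  rintro ⟨Φ, hΦmem, hΦne, hΦP⟩ ⟨Ψ, hΨmem, hΨne, hΨP⟩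
  obtain ⟨φp, hp, hp0, hpK, hp𝔨, hpwt, hpN⟩ := hvh Φ hΦmem hΦne hΦP
  obtain ⟨φm, hm, hm0, hmK, hm𝔨, hmwt, hmN⟩ := hva Ψ hΨmem hΨne hΨP
  exact not_both_types_archModuleCM ι T hT P hF1a φp φm hp0 hpK hp𝔨 hpwt hpN hm0 hmK hm𝔨 hmwt hmN hp hm

end Diag

/-! ## §2 The off-diagonal shrink of letter E2′ -/

/-- **Letter E2′ = its DIAGONAL part + its OFF-DIAGONAL part.**  `Rogawski1990.hodgeTypeRigid` (no irreducible smooth `σ` is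
the finite component of both a holomorphic-type `P` and an antiholomorphic-type `P′`) follows from (diag) «no discrete `P` is of
both cotangent types at `ι`» (E2′₀ — §1 once F1a and the B1′ value maps are supplied; `σ` plays no role) and (off-diag) the same
statement as the letter under the extra hypothesis `P ≠ P′` (the e.v.p.-rigidity of [Rogawski1990, Thm. 13.3.6 (c); §12.3;
Thm. 14.6.4 l. 1]: the one-dimensional `ξ` with `P ∈ Π′(ξ)` is determined by `P_f ≅ σ`, and `ξ_ι` decides `J⁺` versus `J⁻`).
[cite: Rogawski1990, Thm. 13.3.6 (c); §15.3 ¶1; §12.3 p. 174; Thm. 14.6.4] -/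
theorem hodgeTypeRigid_of_diag_of_offDiag
    (hdiag : ∀ (L : Type) [Field L] [NumberField L] [IsCMField L] (ι : L →+* ℂ) (H : Matrix (Fin 3) (Fin 3) L)
      (T : GL (Fin 3) ℂ)
      (hT : (T : Matrix (Fin 3) (Fin 3) ℂ)ᴴ * H.map ι * (T : Matrix (Fin 3) (Fin 3) ℂ) =
        Literature.Geometry.ComplexHyperbolic.BallModel.J),
      (∀ τ' : L →+* ℂ, InfinitePlace.mk τ' ≠ InfinitePlace.mk ι → (H.map τ').PosDef) →
      2 ≤ Module.finrank ℚ ↥(maximalRealSubfield L) →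
      ∀ (μ : Measure (adelicGroupData (↥(maximalRealSubfield L)) L (IsCMField.complexConj L) 3 H).automorphicQuotient)
        [(adelicGroupData (↥(maximalRealSubfield L)) L (IsCMField.complexConj L) 3 H).IsAutomorphicMeasure μ]
        (P : DiscreteAutomorphicRep (adelicGroupData (↥(maximalRealSubfield L)) L (IsCMField.complexConj L) 3 H) μ),
        P.IsHolCotangentAt (cmArchSection L ι H T hT) (cmCompactFactor L ι H T hT) →
          P.IsAntiholCotangentAt (cmArchSection L ι H T hT) (cmCompactFactor L ι H T hT) → False)
    (hoff : ∀ (L : Type) [Field L] [NumberField L] [IsCMField L] (ι : L →+* ℂ) (H : Matrix (Fin 3) (Fin 3) L)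
      (T : GL (Fin 3) ℂ)
      (hT : (T : Matrix (Fin 3) (Fin 3) ℂ)ᴴ * H.map ι * (T : Matrix (Fin 3) (Fin 3) ℂ) =
        Literature.Geometry.ComplexHyperbolic.BallModel.J),
      (∀ τ' : L →+* ℂ, InfinitePlace.mk τ' ≠ InfinitePlace.mk ι → (H.map τ').PosDef) →
      2 ≤ Module.finrank ℚ ↥(maximalRealSubfield L) →
      ∀ (μ : Measure (adelicGroupData (↥(maximalRealSubfield L)) L (IsCMField.complexConj L) 3 H).automorphicQuotient)
        [(adelicGroupData (↥(maximalRealSubfield L)) L (IsCMField.complexConj L) 3 H).IsAutomorphicMeasure μ]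
        (W : Type) [AddCommGroup W] [Module ℂ W]
        (σ : Representation ℂ (finAdelic (↥(maximalRealSubfield L)) L (IsCMField.complexConj L) 3 H) W),
        σ.IsIrreducible → σ.IsSmooth →
      ∀ P P' : DiscreteAutomorphicRep (adelicGroupData (↥(maximalRealSubfield L)) L (IsCMField.complexConj L) 3 H) μ,
        P ≠ P' →
        P.IsHolCotangentAt (cmArchSection L ι H T hT) (cmCompactFactor L ι H T hT) →
        P'.IsAntiholCotangentAt (cmArchSection L ι H T hT) (cmCompactFactor L ι H T hT) →
        P.HasFinComponent σ → P'.HasFinComponent σ → False) :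
    Literature.NumberTheory.Rogawski1990.hodgeTypeRigid := by
  intro L _ _ _ ι H T hT hdef h2 μ _ W _ _ σ hσirr hσsm P P' hP hP' hfP hfP'
  by_cases hPP' : P = P'
  · subst hPP'
    exact hdiag L ι H T hT hdef h2 μ P hP hP'
  · exact hoff L ι H T hT hdef h2 μ W σ hσirr hσsm P P' hPP' hP hP' hfP hfP'

end Summit.HodgeConjecture.HodgeConjecture.Cruxes.H413.F0P3HodgeTypeRigidDiag

end
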